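import Summits.BirchSwinnertonDyer.Rank1Residual.X2.NonsplitIMCEqHalves
import HarnessLib

/-!
# O9 ∩ {SPLIT}: the typed residuals of the split half of crux 4 `BSDpOnCellC` (route
# `EisensteinPrimes`, line b1, stub `stub_split`) — the SPLIT-sign twins of c1 / c2 / c3-div / c3-μλ /
# c3 of `X2/NonsplitBDPExists.lean` and `X2/NonsplitIMCEqHalves.lean` (the ONE construction-class atom
# of the split road, `SplitControlOnTree W p` = the tree's EXISTING control shape `X11b.ControlOnTreeAt`
# at a split Eisenstein `p ‖ N` with torsion allowed, and the assembly live in the companion file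
# `X2/SplitHalvesAssembly.lean`) (cell `bsd-eis`, seat `bsd-eis-cgshw` g6; memo `cgshw-MEMO-7.md`)

HONEST FRAMING (cell `bsd-eis`): five `@[conjecture]`-tagged hypothesis-shaped predicates and two glue
theorems; nothing asserted; nothing booked; X2 stays CONSTRUCTION-SHAPED; no label moves. WHY TWINS and
not a rewrite of the non-split predicates: the accepted non-split files (p404147, p408417) are
append-only and their consumers (p404431/p404695/p407684/p409029) quantify the `¬ split` binder; and the
PRINT STATUS differs by sign in exactly two places, recorded in the docstrings below — c3-div (at a
split `p` the Λ-adic Heegner class has an exceptional zero at `𝟙`, so route R-β runs through the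
DERIVED class `𝐳′_∞` of Castella arXiv:2409.01360 Thm. 2.1–2.2 and needs `ℒ_𝔭(f,K) ≠ 0`, Disegni
2020) and the control theorem (a THEOREM at a non-split `p`, `X2/NonsplitControl.lean` p398508, because
`E(ℚ_p)[p] = 0` there; at a split `p` NOT in print: Keller–Yin v2 App. B's torsion-allowing
architecture with its inputs proved only for `p ∤ N`). MEMO-7 §2 shows that the torsion-allowing exact
control at `𝟙` (KY Thm. B.0.2 + §B.3 with Castella CJM 2018's `p ∣ N` local index) evaluates, for
`E/ℚ` and a CGLS field, to EXACTLY the body of `X11b.ControlOnTreeAt` (the local torsion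
`#E(ℚ_p)[p^∞]` cancels between `C^∅(W)` and `(#δ_v)²`; the global torsion `#E(K)[p^∞]²` is absorbed
by the FULL index `(AddSubgroup.zmultiples P).index = [E(K)_{/tors}:ℤP]·#E(K)_tors`), so the split
road needs NO new control STATEMENT — the companion file's `SplitControlOnTree` quantifies the
existing one over the CGLS data of a split CellC pair. Everything downstream of (CTL) on the non-split road is sign-free
(`R1.imcWaldspurgerOnTreeAt_of_halves`, `exists_shadowLinks_of_onTree_of_heegner`,
`bsdp_of_cellC_of_indexIdentityAt`; MEMO-7 §1), which the companion file `X2/SplitHalvesAssembly.lean`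
exploits. On this road there is NO exceptional-zero identity, NO ℒ-invariant outside c3-div's
`κ₁ ≠ 0`, NO `(γ−1)²` (those concern the Greenberg Selmer group / the Λ-adic Heegner class, not
Castella's relaxed-strict `X_ac`; LIT-DOSSIER §32 (C)).

* `SplitHsiehFrameResidualAt W p` (c1s) — `HsiehFrameResidualAt` with `split` for `¬ split`; Hsieh 2014
  Thm. 1 is sign-free (`𝔑` = prime-to-`p` conductor, `π_p` special allowed); the `R₀`-descent is
  unprinted at a reducible `p ∣ N` for either sign.
* `exists_isBDPLFunction_of_hsieh2014_of_split` — H1 at a split datum DISCHARGED modulo (Hsieh 2014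
  Thm. 1, c1s), by the sign-free glue `exists_isBDPLFunction_of_hsiehDisplay` (p404147).
* `SplitBDPValueOnTree W p` (c2s) — H2 with `a_p = +1`: `L(𝟙) = u·((1 − p⁻¹)·log_ω P)²`; cas-split
  Thm. 2.10/2.11 is stated for a `p`-new eigenform with `a_p(f)² = p^r`, EITHER sign, `p ≥ 5` — so the
  split case is the paper's own standing case; `p = 3 ‖ N`: not in print.
* `SplitKolyvaginDivOnTree W p` (c3s-div), `SplitMuLambdaOnTree W p` (c3s-μλ), `SplitIMCEqOnTree W p`
  (c3s) and `splitIMCEqOnTree_of_div_of_muLambda` (c3s ⇐ c3s-div ∧ c3s-μλ, the kernel algebra of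
  p408417 verbatim).

References: [Hsieh2014] Thm. 1; [CastellaHsieh2018] Def. 3.5, Prop. 3.6; [Castella2018] Thm. 2.3
and its proof (p. 5–6), Thm. 3.1, 3.2, §5; [Castella2018Exceptional] Thm. 2.10, 2.11 (arXiv:1507.04260
p. 13–14); [Castella2024] = arXiv:2409.01360 Thm. 2.1, Thm. 2.2, Prop. 3.2, Thm. 3.4 (PRE);
[KellerYin2024] §5.1, Thm. 5.1.3, App. B Thm. B.0.2, §B.3 (PRE); [JetchevSkinnerWan2017] Thm. 3.3.1,
Prop. 3.2.1, Prop. 3.3.7; [GreenbergLNM1716] §4 Lemma 4.2, Prop. 4.13; [Disegni2020] §2.1;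
[CastellaGrossiSkinner2025] Thm. 5.5.1; [Washington1997] §7.1.
-/

set_option autoImplicit false

noncomputable section

open scoped Classical MatrixGroups ModularForm

open CongruenceSubgroup WeierstrassCurve NumberField IsDedekindDomain Field PowerSeries
  Literature.NumberTheory.EllipticCurves Literature.NumberTheory.EllipticCurves.GreenbergSelmer
  Literature.NumberTheory.EllipticCurves.ModularForms
  Literature.NumberTheory.EllipticCurves.Rank1Residual
  Literature.NumberTheory.EllipticCurves.Rank1Residual.Typed
  Literature.NumberTheory.GaloisRepresentations Literature.NumberTheory.GaloisCohomology
  Literature.NumberTheory.Automorphic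
  Summit.BirchSwinnertonDyer.Rank1Residual.X11b.AcSelmer
  Summit.BirchSwinnertonDyer.Rank1Residual.X11b.Halves
  Summit.BirchSwinnertonDyer.Rank1Residual.X11b
  Summit.BirchSwinnertonDyer.Rank1Residual.X1.KellerYinHalves

namespace Summit.BirchSwinnertonDyer.Rank1Residual.X2

section Residuals

variable (W : WeierstrassCurve ℚ) [W.IsElliptic] [W.IsGloballyMinimal] (p : ℕ) [Fact p.Prime]

/-- **c1s — `SplitHsiehFrameResidualAt W p`: "Hsieh's printed element lands in the tree's frame" at an
X2 ∩ {SPLIT} datum, uniform in the odd prime `p`** (hypothesis-shaped; the split-sign twin of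
`HsiehFrameResidualAt W p`, p404147, from which it differs ONLY in the binder
`W.HasSplitMultiplicativeReductionAtPrime p` replacing its negation — see that docstring for the
term-by-term reading). Over `ι' : ℚ̄_p ≃ ℂ`, `K, 𝔭, κ, γ`, the newform `f` of `E` with `N = N_E`,
`ClassX2 W p`, `p` SPLIT multiplicative, `K` imaginary quadratic with the classical Heegner hypothesis
for `N` (so `p ∣ N` splits in `K`), `𝔭 ∋ p` of degree one, `ι'` inducing `𝔭`, `κ` anticyclotomic
with generator `γ`: (λ) an auxiliary Hecke character of `K` (unitary, type `(1,−1)`, trivial on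
`𝔸_ℚ^×`, unramified outside `p`) with a `p`-adic avatar through `κ`, AND for every Hsieh witness
`(A, Ω_K, C, Ω_p, Q)` (the conclusion of `hsieh2014_exists_anticyclotomicPAdicLFunction` verbatim —
Hsieh 2014 Thm. 1 is SIGN-FREE: «𝔑 = the prime-to-p conductor of π_K ⊗ λ», `π_p` special of either
sign allowed, `p² ∤ N`) an `R₀`-frame `(Ω_K' ≠ 0, Ω_p' ∈ R₀ˣ, L ∈ R₀⟦T⟧)` realising Hsieh's display
with constant `1`. The `R₀ = 𝒪(ℚ̂_p^ur)`-descent is printed only by Castella–Hsieh 2018 Def. 3.5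
(`p ∤ N`) and Castella 2018 Thm. 3.1 (`p ≥ 5`, `E[p]` irreducible, semistable) — NOT at a reducible
`p ∣ N`, for either sign; (HK) rider `p ∤ h_K` as for the twin (MEMO-7 §3 row c1s). TYPED, not
attempted; nothing asserted; consumed as a hypothesis.
[cite: Hsieh2014, Thm. 1 (arXiv:1112.1580 pp. 3–4) (frame of the antecedent; the R₀-descent at p ∣ N for reducible E[p] is NOT in print)]
[cite: CastellaHsieh2018, Def. 3.5 and Prop. 3.6 (arXiv:1505.08165 pp. 10–11) (shape of the consequent, printed for p ∤ N)]
[cite: Castella2018, Thm. 3.1 (arXiv:1704.06608 p. 9) (shape of the consequent, printed for p ≥ 5, E[p] irreducible)] -/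
@[conjecture]
def SplitHsiehFrameResidualAt : Prop :=
  ∀ (ι' : PadicAlgCl p ≃+* ℂ) (K : Type) [Field K] [NumberField K]
    (𝔭 : HeightOneSpectrum (𝓞 K)) (κ : ZpExtension K p) (γ : Field.absoluteGaloisGroup K)
    {N : ℕ} [NeZero N] {f : CuspForm (CongruenceSubgroup.Gamma0 N) 2}, IsNewformOf W f →
    ClassX2 W p → W.HasSplitMultiplicativeReductionAtPrime p → W.conductorNorm ℤ = N →
    IsImaginaryQuadratic K → SatisfiesHeegnerHypothesis N K →
    ((p : ℕ) : 𝓞 K) ∈ 𝔭.asIdeal →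
    𝔭.asIdeal.ramificationIdx (𝓞 ℚ) = 1 → 𝔭.asIdeal.inertiaDeg (𝓞 ℚ) = 1 →
    (∀ (w : InfinitePlace K) (k : 𝓞 K), k ∈ 𝔭.asIdeal ↔ ‖ι'.symm (w.embedding (k : K))‖ < 1) →
    κ.IsAnticyclotomic → κ.IsTopGenerator γ →
    ∃ (lam : HeckeCharacter K) (rlam : FramedGaloisRep K (PadicAlgCl p) 1),
      lam.IsUnitary ∧ lam.HasInfinityType (fun _ ↦ (1 : ℤ)) (fun _ ↦ (-1 : ℤ)) ∧
      (∀ x : ideleGroup ℚ, lam (AdeleRing.ideleBaseChange ℚ K x) = 1) ∧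
      (∀ v : HeightOneSpectrum (𝓞 K), ((p : ℕ) : 𝓞 K) ∉ v.asIdeal → lam.IsUnramifiedAt v) ∧
      IsPAdicAvatarOf ι' lam rlam ∧ FactorsThroughZp κ rlam ∧
      ∀ (A : ℝ) (ΩK C : ℂ) (Ωp : ℂ_[p]) (Q : PowerSeries (PadicComplexInt p)),
        0 < A → ΩK ≠ 0 → ‖((ι'.symm C : PadicAlgCl p) : ℂ_[p])‖ = 1 → ‖Ωp‖ = 1 →
        IsHsiehLFunction ι' 𝔭 κ γ f A ΩK C Ωp Q →
        ∃ (ΩK' : ℂ) (Ωp' : (unrIntegers p)ˣ) (L : UnrSeries p), ΩK' ≠ 0 ∧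
          ∀ (χ : HeckeCharacter K) (n : ℕ), 0 < n →
            (∀ v : HeightOneSpectrum (𝓞 K), χ.IsUnramifiedAt v) →
            χ.HasInfinityType (fun _ ↦ (n : ℤ)) (fun _ ↦ -(n : ℤ)) →
            ∀ r : FramedGaloisRep K (PadicAlgCl p) 1, IsPAdicAvatarOf ι' χ r → FactorsThroughZp κ r →
              L.HasValueAt (avatarValueAt r γ - 1)
                (((ι'.symm (hsiehInterpolationValue p f 𝔭 χ n A ΩK' 1) : PadicAlgCl p) : ℂ_[p]) *
                  ((Ωp' : unrIntegers p) : ℂ_[p]) ^ (4 * n))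

/-- **c2s — `SplitBDPValueOnTree W p`: H2 (value at `𝟙`) on the X2 ∩ {SPLIT} Heegner datum, typed over
the frame** (the split-sign twin of `NonsplitBDPValueOnTree W p`, p404147; differs ONLY in the sign
binder). For every CGLS Heegner datum of a rank-one X2 pair at a SPLIT `p` — level `N = N_E`, `K`
imaginary quadratic with `d_K < −4`, Heegner hypothesis for `N`, `L(E^{d_K},1) ≠ 0`, datum `(Dt, H)`
with `p ∤ c`, Heegner point `P` of infinite order, anticyclotomic `(κ, γ)`, degree-one `𝔭 ∋ p` —,
every newform `f` of `E`, every `ι'` inducing `𝔭`, every frame `(Ω_K ≠ 0, Ω_p ∈ R₀ˣ, L ∈ R₀⟦T⟧)` with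
`IsBDPLFunction ι' 𝔭 κ γ f Ω_K Ω_p L`: `L(𝟙) = u·((1 − a_p(E)·p⁻¹)·log_{ω_E} P)²`, `u ∈ R₀ˣ`, with
`a_p(E) = W.LFunction p = +1` here, i.e. the factor `(1 − p⁻¹)²` — NON-ZERO: the BDP-type `p`-adic
`L`-function has NO exceptional zero at `𝟙` at a split `p ∣ N` (`β_p = 0`, cas-split Thm. 2.10;
LIT-DOSSIER §32 (C)); the exceptional zero of the split sign lives on the Λ-adic Heegner class
(`SplitKolyvaginDivOnTree`), not here. PRINT STATUS: PUB at `p ≥ 5` — Castella JIMJ 17 (2018)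
Thm. 2.10/2.11, stated for «a p-new eigenform f ∈ S_{r+2}(Γ₀(Np))» with `a_p(f)² = p^r`, EITHER sign
(the paper's global standing hypothesis «a_p(f) = 1» IS the split case; §§1–2 use only
`a_p(f)² = p^r`, LIT-DOSSIER §2d (a)); explicit `p ≥ 5` through `E_{p−1}` (§1.4, U1); NOT in print at
`p = 3 ‖ N`. (HK): inherits `p ∤ h_K` AS PRINTED via [Cas20] Def. 1.3 (U1); removable by R-hK
(unwritten). A predicate on `(W, p)`; TYPED, not attempted; nothing asserted; consumed as a hypothesis.
[cite: Castella2018Exceptional, Thm. 2.10 and Thm. 2.11 (arXiv:1507.04260 pp. 13–14) (printed value formula, p ≥ 5, p-new weight 2, either sign of a_p)]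
[cite: Castella2018, Thm. 3.2 (arXiv:1704.06608 p. 9) (shape only; nothing asserted)] -/
@[conjecture]
def SplitBDPValueOnTree : Prop :=
  ∀ (N : ℕ) [NeZero N] (K : Type) [Field K] [NumberField K] (Dt : ModularParametrizationData W N)
    (H : HeegnerDatum N (NumberField.discr K)) (ιK : K →+* ℂ) (P : (W.baseChange K).toAffine.Point),
    CellC W p → W.HasSplitMultiplicativeReductionAtPrime p → W.conductorNorm ℤ = N →
    IsImaginaryQuadratic K → NumberField.discr K < -4 → SatisfiesHeegnerHypothesis N K →
    (W.quadraticTwist (NumberField.discr K : ℚ)).entireLFunction 1 ≠ 0 →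
    WeierstrassCurve.Affine.Point.map ιK.toRatAlgHom P = heegnerPointComplex Dt H →
    ¬ (p : ℤ) ∣ Dt.c → ¬ IsOfFinAddOrder P →
    ∀ (κ : ZpExtension K p), κ.IsAnticyclotomic →
      ∀ (γ : Field.absoluteGaloisGroup K) [Fact (κ.IsTopGenerator γ)]
        (𝔭 : HeightOneSpectrum (𝓞 K)) (h𝔭 : ((p : ℕ) : 𝓞 K) ∈ 𝔭.asIdeal)
        (he : 𝔭.asIdeal.ramificationIdx (𝓞 ℚ) = 1) (hf : 𝔭.asIdeal.inertiaDeg (𝓞 ℚ) = 1),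
        ∀ (f : CuspForm (CongruenceSubgroup.Gamma0 N) 2), IsNewformOf W f →
          ∀ (ι' : PadicAlgCl p ≃+* ℂ),
            (∀ (w : InfinitePlace K) (k : 𝓞 K),
              k ∈ 𝔭.asIdeal ↔ ‖ι'.symm (w.embedding (k : K))‖ < 1) →
            ∀ (ΩK : ℂ) (Ωp : (unrIntegers p)ˣ) (L : UnrSeries p), ΩK ≠ 0 →
              IsBDPLFunction ι' 𝔭 κ γ f ΩK ((Ωp : unrIntegers p) : ℂ_[p]) L →
                R1.BDPValueAtOneOnTreeAt W p (embAt K p 𝔭 h𝔭 he hf) P L (W.LFunction p)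

/-- **c3s-div — `SplitKolyvaginDivOnTree W p`: ONE DIVISIBILITY in the anticyclotomic IMC at a SPLIT
Eisenstein `p ‖ N`, after inverting `p`** (the split-sign twin of `NonsplitKolyvaginDivOnTree W p`,
p408417; same statement — for some `k`, `p^k · L ∈ Ch_Λ(X_ac^∅(E[p^∞]))·R₀⟦T⟧` —, DIFFERENT
provenance). PRINT (route R-β-SPLIT, NOT assembled in print at a reducible `p ‖ N`): at a split `p`
the regularised Λ⁻-adic Heegner class `𝐳_∞` (Bertolini–Darmon 1996 §2.5 (7)–(8): bottom multiplier
`u⁻¹(1 − α⁻¹σ)`, `α = a_p = +1`, augmentation ZERO) has an EXCEPTIONAL ZERO at `𝟙`: Castella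
arXiv:2409.01360 Thm. 2.1 «Suppose E has split multiplicative reduction at p, and that E(K)[p] = 0.
Then pr_0(𝐳_∞) = 0, and its derivative 𝐳′_∞ ∈ Š_p is such that pr_0(𝐳′_∞) = ℒ_𝔭(f,K)·κ_f» (⇐ Molina
TAMS 372 (2019) Thm. 7.5 / Disegni, Kyoto J. Math. 60 (2020) Thm. 5(4), PUB at `p ≥ 5`, `N⁻ = 1`); the
Kolyvagin system is run with `κ_∞ := 𝐳′_∞` (`𝐳_∞ = (γ−1)𝐳′_∞`; uniquely defined when `E(K)[p] = 0`),
`κ₁ ≠ 0` from `κ_f ≠ 0` (Gross–Zagier, analytic rank one) AND `ℒ_𝔭(f,K) ≠ 0` (Disegni 2020 §2.1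
(h norm) «ℓ(q_{A,𝔭}) ≠ 0 by [st et]» ⇐ Barré-Sirieix–Diaz–Gramain–Philibert, PUB) — so Cornut–Vatsal
is again not needed in analytic rank one (MEMO-7 §3, repairing MEMO-6 §4(iv)) —; the reducible
machinery CGLS 2022 Thm. 4.1.1 / Keller–Yin App. A; the abstract Λ-adic bound CGS 2025 Thm. 5.5.1
(PUB); and the index-to-`L`-value conversion by the SPLIT reciprocity law Castella 2024 **Thm. 2.2**
«Assume that E has split multiplicative reduction at p. Then there is a Λ-linear isomorphism
𝓛̃_𝔭 : H¹(K_𝔭,𝓕⁺𝐓)⊗̂R₀ → Λ_{R₀} such that 𝓛̃_𝔭(loc_𝔭(𝐳′_∞)) = L_𝔭(f) up to a p-adic unit» + Prop. 3.2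
(PT-equivalence, stated with `𝐳*_∞ = 𝐳′_∞` at split `p`) — PREPRINT, no image hypothesis as stated,
standing `p > 3` («many of our arguments apply to any odd prime p» — unverified at `p = 3`);
Keller–Yin v2 Thm. `multHg` cites exactly «[Cas24, Thm 2.2, Cor 2.3] for both split and non-split
cases». TYPED, not attempted; nothing asserted; consumed as a hypothesis. [claim: Castella2024, status: under-review]
[cite: CastellaGrossiSkinner2025, Thm. 5.5.1 (shape only; nothing asserted)]
[cite: CastellaGrossiLeeSkinner2022, Thm. 4.1.1 and Rem. 4.1.3 (shape only; nothing asserted)]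
[cite: Disegni2020, §2.1 eq. (h norm) and proof of Thm. 5(4) (arXiv:1609.02528 pp. 8, 17) (ℒ⁻_𝔭 ≠ 0)]
[cite: BertoliniDarmon1996, §2.5 (7)–(8) and Prop. 2.7 (pp. 434–435)] -/
@[conjecture]
def SplitKolyvaginDivOnTree : Prop :=
  ∀ (N : ℕ) [NeZero N] (K : Type) [Field K] [NumberField K] (Dt : ModularParametrizationData W N)
    (H : HeegnerDatum N (NumberField.discr K)) (ιK : K →+* ℂ) (P : (W.baseChange K).toAffine.Point),
    CellC W p → W.HasSplitMultiplicativeReductionAtPrime p → W.conductorNorm ℤ = N →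
    IsImaginaryQuadratic K → NumberField.discr K < -4 → SatisfiesHeegnerHypothesis N K →
    (W.quadraticTwist (NumberField.discr K : ℚ)).entireLFunction 1 ≠ 0 →
    WeierstrassCurve.Affine.Point.map ιK.toRatAlgHom P = heegnerPointComplex Dt H →
    ¬ (p : ℤ) ∣ Dt.c → ¬ IsOfFinAddOrder P →
    ∀ (κ : ZpExtension K p), κ.IsAnticyclotomic →
      ∀ (γ : Field.absoluteGaloisGroup K) [Fact (κ.IsTopGenerator γ)]
        (𝔭 : HeightOneSpectrum (𝓞 K)), ((p : ℕ) : 𝓞 K) ∈ 𝔭.asIdeal →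
        𝔭.asIdeal.ramificationIdx (𝓞 ℚ) = 1 → 𝔭.asIdeal.inertiaDeg (𝓞 ℚ) = 1 →
        ∀ (f : CuspForm (CongruenceSubgroup.Gamma0 N) 2), IsNewformOf W f →
          ∀ (ι' : PadicAlgCl p ≃+* ℂ),
            (∀ (w : InfinitePlace K) (k : 𝓞 K),
              k ∈ 𝔭.asIdeal ↔ ‖ι'.symm (w.embedding (k : K))‖ < 1) →
            ∀ (ΩK : ℂ) (Ωp : (unrIntegers p)ˣ) (L : UnrSeries p), ΩK ≠ 0 →
              IsBDPLFunction ι' 𝔭 κ γ f ΩK ((Ωp : unrIntegers p) : ℂ_[p]) L →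
                ∃ k : ℕ, PowerSeries.C ((p : unrIntegers p) ^ k) * L ∈
                  (XAc.charIdeal (W.baseChange K) p κ 𝔭 ∅ γ).map (PowerSeries.map (toUnr p))

/-- **c3s-μλ — `SplitMuLambdaOnTree W p`: KELLER–YIN D′ (`μ = 0` AND `λ`-EQUALITY) at a SPLIT Eisenstein
`p ‖ N`** (the split-sign twin of `NonsplitMuLambdaOnTree W p`, p408417; same statement: for every
generator `𝓕` of `Ch_Λ(X_ac^∅(E[p^∞]))` and the frame `L`, the first unit coefficients of `𝓕` (read in
`R₀`) and of `L` sit at the same index). PRINT: Keller–Yin arXiv:2402.12781v2 §5.1 («Proof of the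
Iwasawa Main Conjecture with multiplicative reduction»: Hida family through `f` at `p ‖ N`, items
(a)–(e), `Char(𝔛_f)Λ^nr = (𝓛_f)` Thm. 5.1.3) carries NO sign condition — the argument and the located
GAP (item (d): «follows from IMC (IMC2) for good ordinary forms f_m in the previous sections», the
L1754 line; the text proves D′: `μ = 0`, `λ`-equality) are the same for `a_p = ±1`. UNREFEREED
PREPRINT; NEVER cite this `Prop` as a theorem; consumed as a hypothesis. [claim: KellerYin2024, status: under-review]
[cite: KellerYin2024, §5.1 and Thm. 5.1.3 = Thm. D (arXiv:2402.12781v2), the part D′ of its proof]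
[cite: Washington1997, §7.1 Prop. 7.2 and §13.2 (μ, λ as first unit coefficient)] -/
@[conjecture]
def SplitMuLambdaOnTree : Prop :=
  ∀ (N : ℕ) [NeZero N] (K : Type) [Field K] [NumberField K] (Dt : ModularParametrizationData W N)
    (H : HeegnerDatum N (NumberField.discr K)) (ιK : K →+* ℂ) (P : (W.baseChange K).toAffine.Point),
    CellC W p → W.HasSplitMultiplicativeReductionAtPrime p → W.conductorNorm ℤ = N →
    IsImaginaryQuadratic K → NumberField.discr K < -4 → SatisfiesHeegnerHypothesis N K →
    (W.quadraticTwist (NumberField.discr K : ℚ)).entireLFunction 1 ≠ 0 →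
    WeierstrassCurve.Affine.Point.map ιK.toRatAlgHom P = heegnerPointComplex Dt H →
    ¬ (p : ℤ) ∣ Dt.c → ¬ IsOfFinAddOrder P →
    ∀ (κ : ZpExtension K p), κ.IsAnticyclotomic →
      ∀ (γ : Field.absoluteGaloisGroup K) [Fact (κ.IsTopGenerator γ)]
        (𝔭 : HeightOneSpectrum (𝓞 K)), ((p : ℕ) : 𝓞 K) ∈ 𝔭.asIdeal →
        𝔭.asIdeal.ramificationIdx (𝓞 ℚ) = 1 → 𝔭.asIdeal.inertiaDeg (𝓞 ℚ) = 1 →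
        ∀ (f : CuspForm (CongruenceSubgroup.Gamma0 N) 2), IsNewformOf W f →
          ∀ (ι' : PadicAlgCl p ≃+* ℂ),
            (∀ (w : InfinitePlace K) (k : 𝓞 K),
              k ∈ 𝔭.asIdeal ↔ ‖ι'.symm (w.embedding (k : K))‖ < 1) →
            ∀ (ΩK : ℂ) (Ωp : (unrIntegers p)ˣ) (L : UnrSeries p), ΩK ≠ 0 →
              IsBDPLFunction ι' 𝔭 κ γ f ΩK ((Ωp : unrIntegers p) : ℂ_[p]) L →
                ∀ F : IwasawaAlgebra p,
                  XAc.charIdeal (W.baseChange K) p κ 𝔭 ∅ γ = Ideal.span {F} →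
                  ∃ n : ℕ,
                    (‖((PowerSeries.coeff n (PowerSeries.map (toUnr p) F) : unrIntegers p) : ℂ_[p])‖ = 1 ∧
                      ∀ i < n, ‖((PowerSeries.coeff i (PowerSeries.map (toUnr p) F) :
                        unrIntegers p) : ℂ_[p])‖ < 1) ∧
                    (‖((PowerSeries.coeff n L : unrIntegers p) : ℂ_[p])‖ = 1 ∧
                      ∀ i < n, ‖((PowerSeries.coeff i L : unrIntegers p) : ℂ_[p])‖ < 1)

/-- **c3s — `SplitIMCEqOnTree W p`: H3 (anticyclotomic IMC `Ch_Λ(X_ac^∅(E[p^∞]))·R₀⟦T⟧ = (L)` for THAT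
frame `L`) on the X2 ∩ {SPLIT} Heegner datum** (the split-sign twin of `NonsplitIMCEqOnTree W p`,
p404147; differs ONLY in the sign binder; `R1.IMCEqOnTreeAt` shape). PRINT STATUS: Keller–Yin v2
Thm. 5.1.3 (= Thm. D at `p ‖ N`), sign-free, PREPRINT WITH GAP at L1754 (the text proves D′); in the
kernel it is the composition of its two typed halves, `splitIMCEqOnTree_of_div_of_muLambda`. (HK) as
for c2s. THE open analytic input of the split O9 road in its sharpest typed form. A predicate on
`(W, p)`; NEVER a theorem in this cell; every result using it is CONDITIONAL. [claim: KellerYin2024, status: under-review] -/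
@[conjecture]
def SplitIMCEqOnTree : Prop :=
  ∀ (N : ℕ) [NeZero N] (K : Type) [Field K] [NumberField K] (Dt : ModularParametrizationData W N)
    (H : HeegnerDatum N (NumberField.discr K)) (ιK : K →+* ℂ) (P : (W.baseChange K).toAffine.Point),
    CellC W p → W.HasSplitMultiplicativeReductionAtPrime p → W.conductorNorm ℤ = N →
    IsImaginaryQuadratic K → NumberField.discr K < -4 → SatisfiesHeegnerHypothesis N K →
    (W.quadraticTwist (NumberField.discr K : ℚ)).entireLFunction 1 ≠ 0 →
    WeierstrassCurve.Affine.Point.map ιK.toRatAlgHom P = heegnerPointComplex Dt H →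
    ¬ (p : ℤ) ∣ Dt.c → ¬ IsOfFinAddOrder P →
    ∀ (κ : ZpExtension K p), κ.IsAnticyclotomic →
      ∀ (γ : Field.absoluteGaloisGroup K) [Fact (κ.IsTopGenerator γ)]
        (𝔭 : HeightOneSpectrum (𝓞 K)), ((p : ℕ) : 𝓞 K) ∈ 𝔭.asIdeal →
        𝔭.asIdeal.ramificationIdx (𝓞 ℚ) = 1 → 𝔭.asIdeal.inertiaDeg (𝓞 ℚ) = 1 →
        ∀ (f : CuspForm (CongruenceSubgroup.Gamma0 N) 2), IsNewformOf W f →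
          ∀ (ι' : PadicAlgCl p ≃+* ℂ),
            (∀ (w : InfinitePlace K) (k : 𝓞 K),
              k ∈ 𝔭.asIdeal ↔ ‖ι'.symm (w.embedding (k : K))‖ < 1) →
            ∀ (ΩK : ℂ) (Ωp : (unrIntegers p)ˣ) (L : UnrSeries p), ΩK ≠ 0 →
              IsBDPLFunction ι' 𝔭 κ γ f ΩK ((Ωp : unrIntegers p) : ℂ_[p]) L →
                R1.IMCEqOnTreeAt W p κ 𝔭 γ L

end Residuals

/-! ### c3s from its two halves (the kernel algebra of p408417, verbatim) -/

section Halves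

variable {W : WeierstrassCurve ℚ} [W.IsElliptic] [W.IsGloballyMinimal] {p : ℕ} [Fact p.Prime]

omit [W.IsElliptic] [W.IsGloballyMinimal] in
/-- **H3 at a split `p` from its two halves, in the kernel: ONE DIVISIBILITY (c3s-div, R-β-split) +
`μ = 0` and `λ`-EQUALITY (c3s-μλ, KY D′) ⟹ `Ch_Λ(X_ac^∅)·R₀⟦T⟧ = (L)` (`SplitIMCEqOnTree W p`)** — the
split-sign twin of `nonsplitIMCEqOnTree_of_div_of_muLambda` (p408417), same `R₀⟦T⟧` algebra
(`span_singleton_eq_of_C_pow_mul_mem`, `charIdeal_isPrincipal_holds`). CONDITIONAL on the two typed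
halves; nothing booked. [cite: KellerYin2024, proof of Thm. 3.0.8 (the same algebra, TeX L1631–L1640)]
[cite: Washington1997, §7.1 Prop. 7.2] -/
theorem splitIMCEqOnTree_of_div_of_muLambda (hdiv : SplitKolyvaginDivOnTree W p)
    (hml : SplitMuLambdaOnTree W p) : SplitIMCEqOnTree W p := by
  intro N _ K _ _ Dt H ιK P hc hs hN hK hd4 hHN hLt hP hcM hPinf κ hκ γ _ 𝔭 h𝔭 he hf f hfW ι' hι'
    ΩK Ωp L hΩK hL
  obtain ⟨k, hk⟩ := hdiv N K Dt H ιK P hc hs hN hK hd4 hHN hLt hP hcM hPinf κ hκ γ 𝔭 h𝔭 he hf f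
    hfW ι' hι' ΩK Ωp L hΩK hL
  obtain ⟨F, hF⟩ :=
    (charIdeal_isPrincipal_holds p (XAc (W.baseChange K) p κ 𝔭 ∅ γ)).principal
  have hchar : XAc.charIdeal (W.baseChange K) p κ 𝔭 ∅ γ = Ideal.span {F} := hF
  obtain ⟨n, hFn, hLn⟩ := hml N K Dt H ιK P hc hs hN hK hd4 hHN hLt hP hcM hPinf κ hκ γ 𝔭 h𝔭 he
    hf f hfW ι' hι' ΩK Ωp L hΩK hL F hchar
  unfold R1.IMCEqOnTreeAt
  rw [hchar, Ideal.map_span, Set.image_singleton] at hk ⊢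
  exact span_singleton_eq_of_C_pow_mul_mem hk hFn hLn

end Halves

/-! ### H1 DISCHARGED modulo (Hsieh 2014 Thm. 1, c1s) at an X2 ∩ {split} datum -/

section Existence

variable (W : WeierstrassCurve ℚ) [W.IsElliptic] [W.IsGloballyMinimal] (p : ℕ) [Fact p.Prime]

omit [W.IsGloballyMinimal] in
/-- **`hsieh2014_exists_anticyclotomicPAdicLFunction ∧ SplitHsiehFrameResidualAt W p ⟹` a frame with
`IsBDPLFunction` EXISTS at every X2 ∩ {SPLIT} datum** — the split-sign twin of
`exists_isBDPLFunction_of_hsieh2014_of_not_split` (p404147), same proof: Hsieh's theorem is fed with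
`p ≠ 2` and `p` multiplicative from `ClassX2 W p` (so `p² ∤ N = N_E`), `IsNewformOf W f ⇒ IsNewform0 f`,
`p` split in `K` from the classical Heegner hypothesis (`p ∣ N`), `𝔭 ∋ p`, `ι'` inducing `𝔭`, `κ`
anticyclotomic with generator `γ`, and the residual's `(λ, r_λ)`; the residual turns the witness into an
`R₀`-frame in Hsieh's display; the sign-free glue `exists_isBDPLFunction_of_hsiehDisplay` rescales the
period. NO irreducibility, NO square-freeness, NO `p ≥ 5`, and the sign of `a_p` never enters.
CONDITIONAL on the named fact `hH` (Hsieh 2014 Thm. 1, published) and the named residual `hres` (NOT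
in print); nothing booked. [cite: Hsieh2014, Thm. 1 (arXiv:1112.1580 pp. 3–4)] -/
theorem exists_isBDPLFunction_of_hsieh2014_of_split
    (hH : hsieh2014_exists_anticyclotomicPAdicLFunction) (hres : SplitHsiehFrameResidualAt W p)
    (ι' : PadicAlgCl p ≃+* ℂ) {K : Type} [Field K] [NumberField K]
    (𝔭 : HeightOneSpectrum (𝓞 K)) (κ : ZpExtension K p) (γ : Field.absoluteGaloisGroup K)
    {N : ℕ} [NeZero N] {f : CuspForm (CongruenceSubgroup.Gamma0 N) 2} (hfW : IsNewformOf W f)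
    (hX : ClassX2 W p) (hs : W.HasSplitMultiplicativeReductionAtPrime p)
    (hN : W.conductorNorm ℤ = N) (hK : IsImaginaryQuadratic K) (hHN : SatisfiesHeegnerHypothesis N K)
    (h𝔭 : ((p : ℕ) : 𝓞 K) ∈ 𝔭.asIdeal) (he : 𝔭.asIdeal.ramificationIdx (𝓞 ℚ) = 1)
    (hf : 𝔭.asIdeal.inertiaDeg (𝓞 ℚ) = 1)
    (hι' : ∀ (w : InfinitePlace K) (k : 𝓞 K), k ∈ 𝔭.asIdeal ↔ ‖ι'.symm (w.embedding (k : K))‖ < 1)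
    (hκ : κ.IsAnticyclotomic) (hγ : κ.IsTopGenerator γ) :
    ∃ (ΩK : ℂ) (Ωp : (unrIntegers p)ˣ) (L : UnrSeries p),
      ΩK ≠ 0 ∧ IsBDPLFunction ι' 𝔭 κ γ f ΩK ((Ωp : unrIntegers p) : ℂ_[p]) L := by
  obtain ⟨lam, rlam, hunit, hinfl, hAQ, hunrl, havl, hfacl, hR⟩ :=
    hres ι' K 𝔭 κ γ hfW hX hs hN hK hHN h𝔭 he hf hι' hκ hγ
  have hpN : p ∣ N := hN ▸ X11b.dvd_conductorNorm_of_mult (W := W) hX.2.2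
  have hp2N : ¬ p ^ 2 ∣ N :=
    hN ▸ _root_.Summit.BirchSwinnertonDyer.Rank1Residual.X2.not_sq_dvd_conductorNorm_of_mult W p hX.2.2
  obtain ⟨A, ΩK, C, Ωp, Q, hA, hΩK, hC, hΩp, hQ⟩ := hH ι' K 𝔭 κ γ f lam rlam hX.1 hfW.1 hp2N hK
    (hHN p Fact.out hpN) h𝔭 hι' hHN hunit hinfl hAQ hunrl havl hfacl hκ hγ
  obtain ⟨ΩK', Ωp', L, hΩK', hL⟩ := hR A ΩK C Ωp Q hA hΩK hC hΩp hQ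
  obtain ⟨ΩK₁, hΩK₁, hBDP⟩ := exists_isBDPLFunction_of_hsiehDisplay p ι' 𝔭 κ γ f hpN hA hΩK'
    ((Ωp' : unrIntegers p) : ℂ_[p]) L hL
  exact ⟨ΩK₁, Ωp', L, hΩK₁, hBDP⟩

end Existence

end Summit.BirchSwinnertonDyer.Rank1Residual.X2

end
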